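import Summits.Ventures.PercRepro.C041SkeletonCountSum

/-!
# THEOREM R on skeletons, singleton-attachment family: the sum over all colourings (p6, gen 23)

Setting of `C041SkeletonCountSum`.  Every source of the singleton family lies in exactly one `srcSet O`, `O` = its
bare part with the terminal edges set to `false` (`bareOf S`); summing `sum_goodDegree_nonneg_of_bare` over `O` gives
ROW C-041 `(G⅔)` restricted to the singleton-attachment sources as ONE inequality (`sum_goodDegree_nonneg_sing`):
`0 ≤ Σ_{S singleton-family source} (3·[Good_a S] + 3·[Good_b S] − 2)`, on every skeleton with a terminal edge, the
probe not adjacent to a terminal, `a ≠ b`, `c ≠ a, b`, and at most one edge from a vertex to each terminal.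
-/

namespace PercRepro

namespace MultiGraph

open Finset PortProblem

variable {V E : Type*} {G : MultiGraph V E}

section All

variable [Fintype V] [Fintype E] [DecidableEq E] (a b c : V) (hc : ∀ e, ¬ G.Joins e c a ∧ ¬ G.Joins e c b)
  (hca : c ≠ a) (hcb : c ≠ b) (hne : a ≠ b) (huniq : G.UniqTerm a b) (habE : ∃ e, G.Joins e a b)

open Classical in
/-- The bare part of a configuration (the terminal edges set to `false`). -/
noncomputable def bareOf (G : MultiGraph V E) (a b : V) (S : Config E) : Config E :=
  fun e => if G.Bare a b e then S e else false

open Classical in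
/-- The singleton-family sources. -/
noncomputable def singSrc : Finset (Config E) :=
  univ.filter fun S : Config E => G.Sing a b S ∧
    ((G.Conn S c a ∧ G.Conn S c b) ∧ (¬ G.Conn Sᶜ c a ∧ ¬ G.Conn Sᶜ c b ∧ ¬ G.Conn Sᶜ a b))

omit [Fintype V] [Fintype E] [DecidableEq E] in
open Classical in
/-- A configuration agrees with its bare part on the bare edges. -/
theorem agreeBare_bareOf (S : Config E) : G.AgreeBare a b (G.bareOf a b S) S := by
  intro e he
  unfold bareOf
  rw [if_pos he]

omit [Fintype V] [Fintype E] [DecidableEq E] in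
open Classical in
/-- Two configurations with the same bare part agree on the bare edges. -/
theorem agreeBare_of_bareOf_eq {S S' : Config E} (h : G.bareOf a b S' = G.bareOf a b S) :
    G.AgreeBare a b (G.bareOf a b S) S' := by
  intro e he
  have := congrFun h e
  unfold bareOf at this
  rw [if_pos he, if_pos he] at this
  unfold bareOf
  rw [if_pos he]
  exact this

omit [Fintype V] [Fintype E] [DecidableEq E] in
open Classical in
/-- Agreeing on the bare edges means having the same bare part. -/
theorem bareOf_eq_of_agreeBare {S S' : Config E} (h : G.AgreeBare a b (G.bareOf a b S) S') :
    G.bareOf a b S' = G.bareOf a b S := by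
  funext e
  unfold bareOf
  by_cases he : G.Bare a b e
  · rw [if_pos he, if_pos he]
    have := h e he
    unfold bareOf at this
    rw [if_pos he] at this
    exact this
  · rw [if_neg he, if_neg he]

omit [Fintype V] in
open Classical in
/-- **The fibre of the bare part is `srcSet`.** -/
theorem filter_bareOf_eq (S₀ : Config E) :
    (G.singSrc a b c).filter (fun S => G.bareOf a b S = G.bareOf a b S₀) = G.srcSet a b c (G.bareOf a b S₀) := by
  ext S
  unfold singSrc srcSet
  simp only [mem_filter, mem_univ, true_and]
  constructor
  · rintro ⟨⟨hsing, hDA⟩, hb⟩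
    exact ⟨agreeBare_of_bareOf_eq a b hb, hsing, hDA⟩
  · rintro ⟨hagree, hsing, hDA⟩
    exact ⟨⟨hsing, hDA⟩, bareOf_eq_of_agreeBare a b hagree⟩

include hc hca hcb hne huniq habE in
open Classical in
/-- **ROW C-041 `(G⅔)` on the singleton-attachment sources** (THEOREM R, singleton family, summed over the
colourings): `0 ≤ Σ_{S ∈ singSrc} (3·[Good_a S] + 3·[Good_b S] − 2)`. -/
theorem sum_goodDegree_nonneg_sing :
    0 ≤ ∑ S ∈ G.singSrc a b c,
      ((if G.WalkAvoiding S (G.cluster Sᶜ a) c b then (3 : ℤ) else 0) +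
        (if G.WalkAvoiding S (G.cluster Sᶜ b) c a then 3 else 0) - 2) := by
  rw [← Finset.sum_fiberwise (G.singSrc a b c) (G.bareOf a b)]
  apply Finset.sum_nonneg
  intro O _
  by_cases h : ((G.singSrc a b c).filter fun S => G.bareOf a b S = O).Nonempty
  · obtain ⟨S₀, hS₀⟩ := h
    rw [mem_filter] at hS₀
    rw [← hS₀.2, filter_bareOf_eq a b c S₀]
    exact sum_goodDegree_nonneg_of_bare a b c hc hca hcb hne huniq habE _
  · rw [Finset.not_nonempty_iff_eq_empty.1 h, Finset.sum_empty]

end All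

end MultiGraph

end PercRepro
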